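import Summits.ResolutionOfSingularities.ResolutionOfSingularities.Theorems.FrobeniusLadderFInjectiveMacaulayficationKLocCellRange
import Summits.ResolutionOfSingularities.ResolutionOfSingularities.Theorems.FrobeniusLadderFInjectiveMacaulayficationKLocCellKit
import HarnessLib

/-!
# `KLocCell` in `u`-SPACE (Frobenius form): the cofactor identity WITHOUT `expand` and without the `(p-1)`-st power in the cofactors
# (crux `FInjectiveMacaulayfication`, road B; for the `gb-unit-lift` strata of T⁽⁴⁾/7 whose kit-faithful cofactor `t₀ = expand(B)·g⁶`
# has ≈ 900 terms and exhausts the kernel — res-D-pv-040 T4 RELEASE 11:28:31Z open item; seat res-L1-w45a-stub-1)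

Support file for crux stmt-ResolutionOfSingularities-15315 (`FrobeniusLadder.FInjectiveMacaulayfication`), chain w45a. [OURS · L1 W4.5a] —
NOT a statement of the manuscript [claim: Hironaka2017]; AI-written, weaker than expert review.

res-L1-w45a-tri-1's Gröbner certificates for a stratum `S` are computed in the `u = Y^p` coordinates and are «power-free»:
`1 = Σ_α A_α(u)·s_α(u) + B(u)·g^(φ)(u) + Σ_{i ∈ S} τ_i(u)·u_i`, where `g^(p-1) = Σ_α Y^α · s_α(Y^p)` is the residue split and
`g^(φ) = MvPolynomial.map (frobenius k p) g` (`= g` for integer data). Pulled back along `u = Y^p` this is the §2 identity of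
`KLocCell` with `rr_α = expand A_α`, `t_i = expand τ_i · Y_i^(p-1)`, `t₀ = expand B · g^(p-1)` — the last product is what blows up.
THIS FILE proves that the `u`-space identity ITSELF certifies Fedder's test: at a point `a` with `a_i = 0 (i ∈ S)` and `g(a) = 0`,
evaluate at `a^p`: `s_α(a^p) = (expand p s_α)(a)`, `u_i ↦ a_i^p = 0`, `g^(φ)(a^p) = g(a)^p = 0`, so some `(expand p s_α)(a) ≠ 0`, and
res-L1-w45a-stub-3's `FaceFPureOfMonomialPCoeff.fedder_of_aeval_expand_ne_zero` applies exactly as in `KLocCell.fedderAt_of_kLocCell`.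
A kit variant `checkKU` (normal form `Σ_α R_α·s_α + Σ_{i∈S} T_i·Y_i + T₀·G − 1` with NO `expandK` and NO power of `G`; same split) then
certifies the 7 omitted charts with tri-1's short cofactors; its soundness targets `fedderAt_of_kLocCellU` below.

* `aeval_pow_map_frobenius` — `g^(φ)(a^p) = g(a)^p`;
* `fedderAt_of_kLocCellU` — **§2 in `u`-space**: split (as in Sig §2) + `1 = Σ rr_e · e.2 + Σ_{i∈S} t i · Y_i + t₀ · g^(φ)` ⟹ Fedder's
  test at every `K`-point of the stratum on `V(g)`;
* `fedderAt_of_kLocCellU_int` — the same with `t₀ · g` for `g` fixed by the coefficientwise Frobenius (integer data);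
* `pointFedder_of_kLocCellsU`, `honQuot_of_kLocCellsU_range` — cover + `u`-cells ⟹ the `hon'` binder of `ciCertificates` at `r = 1`
  (through `KLocCellRange.quotientChartClause_of_pointFedder_range`), i.e. a drop-in producer for `RoadBFrame.originPointFixable_of_hon`.

No definitions, no named facts; glue. [cite: Fedder1983, Prop. 1.7 and Thm. 1.12; folklore]
-/

-- single-problem summit: the doubled namespace component is forced
set_option linter.dupNamespace false

noncomputable section

namespace Summit.ResolutionOfSingularities.ResolutionOfSingularities.Theorems.FInjectiveMacaulayfication.KLocCellFrobenius

open MvPolynomial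
open Summit.ResolutionOfSingularities.ResolutionOfSingularities.Theorems.FInjectiveMacaulayfication

/-- `g^(φ)(a^p) = g(a)^p`: evaluating the coefficientwise Frobenius twist at the `p`-th powers (any field `K ⊇ k` of
characteristic `p`). [folklore] -/
theorem aeval_pow_map_frobenius (p : ℕ) [Fact p.Prime] {k : Type} [Field k] [CharP k p] {n : ℕ}
    {K : Type} [Field K] [Algebra k K] (b : Fin n → K) (e : MvPolynomial (Fin n) k) :
    aeval (fun i : Fin n => b i ^ p) (MvPolynomial.map (frobenius k p) e) = (aeval b e) ^ p := by
  haveI : CharP K p := charP_of_injective_algebraMap (algebraMap k K).injective p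
  rw [MvPolynomial.aeval_def, MvPolynomial.aeval_def, MvPolynomial.eval₂_map, RingHom.frobenius_comm]
  exact (MvPolynomial.eval₂_comp_left (frobenius K p) (algebraMap k K) b e).symm

/-- Evaluation kills a `zipWith`-sum whose second factors it kills (unexpanded form). [folklore] -/
theorem aeval_zipWith_sum_eq_zero {k : Type} [Field k] {n : ℕ} {K : Type} [CommRing K] [Algebra k K]
    (a : Fin n → K) : ∀ (rr : List (MvPolynomial (Fin n) k)) (L : List ((Fin n →₀ ℕ) × MvPolynomial (Fin n) k)),
      (∀ e ∈ L, aeval a e.2 = 0) → aeval a (List.zipWith (fun r e => r * e.2) rr L).sum = 0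
  | [], L, _ => by simp
  | r :: rr, [], _ => by simp
  | r :: rr, e :: L, h => by
      rw [List.zipWith_cons_cons, List.sum_cons, map_add, map_mul, h e (by simp), mul_zero, zero_add]
      exact aeval_zipWith_sum_eq_zero a rr L fun e' he' => h e' (by simp [he'])

/-- **§2 IN `u`-SPACE (Frobenius form).** With a distinct-exponent split `g^(p-1) = Σ_{e ∈ L} Y^{e.1} · expand p e.2` (`e.1 < p`)
and a `u`-space cofactor identity `1 = Σ rr_e · e.2 + Σ_{i∈S} t i · Y_i + t₀ · g^(φ)` (`g^(φ) = map (frobenius k p) g`; NO `expand`,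
NO power of `g`): for every field `K ⊇ k` and every `K`-point `a` with `a_i = 0` (`i ∈ S`) and `g(a) = 0`,
`(g ⊗ K)^(p-1) ∉ ((Y_i − a_i)^p : i)`. [cite: Fedder1983, Prop. 1.7; folklore] -/
theorem fedderAt_of_kLocCellU (p : ℕ) [Fact p.Prime] (k : Type) [Field k] [CharP k p] (n : ℕ)
    (S : Finset (Fin n)) (g : MvPolynomial (Fin n) k)
    (L : List ((Fin n →₀ ℕ) × MvPolynomial (Fin n) k)) (rr : List (MvPolynomial (Fin n) k))
    (t : Fin n → MvPolynomial (Fin n) k) (t₀ : MvPolynomial (Fin n) k)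
    (hnd : (L.map Prod.fst).Nodup) (hbd : ∀ e ∈ L, ∀ i : Fin n, e.1 i < p)
    (hsplit : g ^ (p - 1) = (L.map fun e => MvPolynomial.monomial e.1 (1 : k) * MvPolynomial.expand p e.2).sum)
    (hcof : (1 : MvPolynomial (Fin n) k) = (List.zipWith (fun r e => r * e.2) rr L).sum +
      ∑ i ∈ S, t i * MvPolynomial.X i + t₀ * MvPolynomial.map (frobenius k p) g)
    (K : Type) [Field K] [Algebra k K] (a : Fin n → K) (haS : ∀ i ∈ S, a i = 0) (hga : MvPolynomial.aeval a g = 0) :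
    (MvPolynomial.map (algebraMap k K) g) ^ (p - 1) ∉
      Ideal.span (Set.range fun i : Fin n => (MvPolynomial.X i - MvPolynomial.C (a i)) ^ p) := by
  classical
  have hp : 0 < p := (Fact.out : p.Prime).pos
  -- some `e.2 (a^p) ≠ 0`: evaluate the cofactor identity at `a^p`
  have hex : ∃ e ∈ L, aeval (fun i : Fin n => a i ^ p) e.2 ≠ 0 := by
    by_contra hall
    push Not at hall
    have h := congrArg (MvPolynomial.aeval (fun i : Fin n => a i ^ p)) hcof
    rw [map_one, map_add, map_add, aeval_zipWith_sum_eq_zero _ rr L hall, map_sum, map_mul, aeval_pow_map_frobenius p a g,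
      hga, zero_pow (Fact.out : p.Prime).ne_zero, mul_zero,
      add_zero, zero_add] at h
    refine one_ne_zero (h.trans (Finset.sum_eq_zero fun i hi => ?_))
    rw [map_mul, MvPolynomial.aeval_X, haS i hi, zero_pow (Fact.out : p.Prime).ne_zero, mul_zero]
  -- residue classes of the (reduced) exponents
  let cls : (Fin n →₀ ℕ) → (Fin n → Fin p) := fun γ j => ⟨γ j % p, Nat.mod_lt _ hp⟩
  have hcls : ∀ e ∈ L, (Finsupp.equivFunOnFinite.symm fun j => ((cls e.1 j : ℕ)) : Fin n →₀ ℕ) = e.1 := by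
    intro e he
    ext j
    simp only [Finsupp.coe_equivFunOnFinite_symm, cls]
    exact Nat.mod_eq_of_lt (hbd e he j)
  have hinj : ∀ e ∈ L, ∀ e' ∈ L, cls e.1 = cls e'.1 → e = e' := by
    intro e he e' he' h
    have h2 := congrArg (fun β : Fin n → Fin p => (Finsupp.equivFunOnFinite.symm fun j => ((β j : ℕ)) : Fin n →₀ ℕ)) h
    rw [hcls e he, hcls e' he'] at h2
    exact List.inj_on_of_nodup_map hnd he he' h2
  have hL : L.Nodup := List.Nodup.of_map _ hnd
  let c : (Fin n → Fin p) → MvPolynomial (Fin n) k := fun α => ∑ e ∈ L.toFinset with cls e.1 = α, e.2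
  have hF : g ^ (p - 1) = ∑ α : Fin n → Fin p, MvPolynomial.expand p (c α) *
      MvPolynomial.monomial (Finsupp.equivFunOnFinite.symm fun j => ((α j : ℕ))) 1 := by
    rw [hsplit, ← List.sum_toFinset _ hL]
    symm
    calc ∑ α : Fin n → Fin p, MvPolynomial.expand p (c α) *
          MvPolynomial.monomial (Finsupp.equivFunOnFinite.symm fun j => ((α j : ℕ))) 1
        = ∑ α : Fin n → Fin p, ∑ e ∈ L.toFinset with cls e.1 = α,
            MvPolynomial.monomial e.1 (1 : k) * MvPolynomial.expand p e.2 := by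
          refine Finset.sum_congr rfl fun α _ => ?_
          simp only [c, map_sum, Finset.sum_mul]
          refine Finset.sum_congr rfl fun e he => ?_
          rw [Finset.mem_filter] at he
          rw [mul_comm, ← he.2, hcls e (List.mem_toFinset.mp he.1)]
      _ = ∑ e ∈ L.toFinset, MvPolynomial.monomial e.1 (1 : k) * MvPolynomial.expand p e.2 :=
          Finset.sum_fiberwise L.toFinset (fun e => cls e.1) _
  obtain ⟨e₀, he₀, hne⟩ := hex
  have hc : aeval (fun i : Fin n => a i ^ p) (c (cls e₀.1)) = aeval (fun i : Fin n => a i ^ p) e₀.2 := by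
    simp only [c, map_sum]
    refine Finset.sum_eq_single_of_mem e₀ (Finset.mem_filter.mpr ⟨List.mem_toFinset.mpr he₀, rfl⟩) fun e he hne' => ?_
    exact absurd (hinj e (List.mem_toFinset.mp (Finset.mem_filter.mp he).1) e₀ he₀ (Finset.mem_filter.mp he).2) hne'
  refine FaceFPureOfMonomialPCoeff.fedder_of_aeval_expand_ne_zero p g c hF a ⟨cls e₀.1, ?_⟩
  rw [MvPolynomial.aeval_expand]
  change aeval (fun i : Fin n => a i ^ p) (c (cls e₀.1)) ≠ 0
  rw [hc]
  exact hne

/-- **§2 in `u`-space, integer data**: the same with the identity written against `g` itself, for `g` fixed by the coefficientwise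
Frobenius (`map (frobenius k p) g = g`, e.g. `KLocCellKit.evalL` of an integer term list). [folklore] -/
theorem fedderAt_of_kLocCellU_int (p : ℕ) [Fact p.Prime] (k : Type) [Field k] [CharP k p] (n : ℕ)
    (S : Finset (Fin n)) (g : MvPolynomial (Fin n) k) (hfrob : MvPolynomial.map (frobenius k p) g = g)
    (L : List ((Fin n →₀ ℕ) × MvPolynomial (Fin n) k)) (rr : List (MvPolynomial (Fin n) k))
    (t : Fin n → MvPolynomial (Fin n) k) (t₀ : MvPolynomial (Fin n) k)
    (hnd : (L.map Prod.fst).Nodup) (hbd : ∀ e ∈ L, ∀ i : Fin n, e.1 i < p)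
    (hsplit : g ^ (p - 1) = (L.map fun e => MvPolynomial.monomial e.1 (1 : k) * MvPolynomial.expand p e.2).sum)
    (hcof : (1 : MvPolynomial (Fin n) k) = (List.zipWith (fun r e => r * e.2) rr L).sum +
      ∑ i ∈ S, t i * MvPolynomial.X i + t₀ * g)
    (K : Type) [Field K] [Algebra k K] (a : Fin n → K) (haS : ∀ i ∈ S, a i = 0) (hga : MvPolynomial.aeval a g = 0) :
    (MvPolynomial.map (algebraMap k K) g) ^ (p - 1) ∉
      Ideal.span (Set.range fun i : Fin n => (MvPolynomial.X i - MvPolynomial.C (a i)) ^ p) :=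
  fedderAt_of_kLocCellU p k n S g L rr t t₀ hnd hbd hsplit (by rw [hfrob]; exact hcof) K a haS hga

/-- **Integer term lists are fixed by the coefficientwise Frobenius** (`KLocCellKit.evalL`: every coefficient is an integer cast,
and `frobenius` fixes the prime field). [folklore] -/
theorem map_frobenius_evalL (p : ℕ) [Fact p.Prime] (k : Type) [Field k] [CharP k p] {n : ℕ} (G : List (ℤ × (Fin n → ℕ))) :
    MvPolynomial.map (frobenius k p) (KLocCellKit.evalL k G) = KLocCellKit.evalL k G := by
  unfold KLocCellKit.evalL
  rw [map_list_sum, List.map_map]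
  congr 1
  refine List.map_congr_left fun t _ => ?_
  rw [Function.comp_apply, MvPolynomial.map_monomial, map_intCast]

section Chart

variable (p : ℕ) [Fact p.Prime] (k : Type) [Field k] [CharP k p] (n : ℕ)

/-- **COVER + `u`-CELLS ⟹ FEDDER AT EVERY POINT UNDER THE CENTRE** (as `KLocCell.pointFedder_of_kLocCells`, with the `u`-space cell
for an integer-fixed `g`). [folklore; cite: Fedder1983, Prop. 1.7] -/
theorem pointFedder_of_kLocCellsU (J : Finset (Fin n)) (V : Matrix (Fin n) (Fin n) ℕ) (g : MvPolynomial (Fin n) k)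
    (hfrob : MvPolynomial.map (frobenius k p) g = g) (SS : List (Finset (Fin n)))
    (hcov : ∀ T : Finset (Fin n), (∀ j ∈ J, ∃ i ∈ T, 0 < V i j) → ∃ S ∈ SS, S ⊆ T)
    (hcells : ∀ S ∈ SS, ∃ (L : List ((Fin n →₀ ℕ) × MvPolynomial (Fin n) k)) (rr : List (MvPolynomial (Fin n) k))
        (t : Fin n → MvPolynomial (Fin n) k) (t₀ : MvPolynomial (Fin n) k),
        (L.map Prod.fst).Nodup ∧ (∀ e ∈ L, ∀ i : Fin n, e.1 i < p) ∧
        g ^ (p - 1) = (L.map fun e => MvPolynomial.monomial e.1 (1 : k) * MvPolynomial.expand p e.2).sum ∧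
        (1 : MvPolynomial (Fin n) k) = (List.zipWith (fun r e => r * e.2) rr L).sum +
          ∑ i ∈ S, t i * MvPolynomial.X i + t₀ * g)
    (K : Type) [Field K] [Algebra k K] (b : Fin n → K) (hgb : MvPolynomial.aeval b g = 0)
    (hθ : ∀ j ∈ J, MvPolynomial.aeval b (∏ i : Fin n, (X i : MvPolynomial (Fin n) k) ^ V i j) = 0) :
    (MvPolynomial.map (algebraMap k K) g) ^ (p - 1) ∉
        Ideal.span (Set.range fun i : Fin n => (MvPolynomial.X i - MvPolynomial.C (b i)) ^ p) := by
  classical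
  have hT : ∀ j ∈ J, ∃ i ∈ (Finset.univ.filter fun i : Fin n => b i = 0), 0 < V i j := by
    intro j hj
    have h := hθ j hj
    rw [map_prod, Finset.prod_eq_zero_iff] at h
    obtain ⟨i, -, hi⟩ := h
    rw [map_pow, MvPolynomial.aeval_X, pow_eq_zero_iff'] at hi
    exact ⟨i, Finset.mem_filter.mpr ⟨Finset.mem_univ i, hi.1⟩, Nat.pos_of_ne_zero hi.2⟩
  obtain ⟨S, hS, hST⟩ := hcov _ hT
  obtain ⟨L, rr, t, t₀, hnd, hbd, hsplit, hcof⟩ := hcells S hS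
  exact fedderAt_of_kLocCellU_int p k n S g hfrob L rr t t₀ hnd hbd hsplit hcof K b
    (fun i hi => (Finset.mem_filter.mp (hST hi)).2) hgb

/-- **`hon'` (r = 1, `Set.range` form) FROM `u`-CELLS** — drop-in twin of `KLocCellRange.honQuot_of_kLocCells_range` for charts whose
cells are certified in `u`-space (`gs 0` integer-fixed: `map (frobenius k p) (gs 0) = gs 0`). [folklore; cite: Fedder1983, Prop. 1.7
and Thm. 1.12] -/
theorem honQuot_of_kLocCellsU_range (J : Finset (Fin n)) (V : Matrix (Fin n) (Fin n) ℕ) (gs : Fin 1 → MvPolynomial (Fin n) k)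
    (hg0 : gs 0 ≠ 0) (hX : ∀ i : Fin n, ¬ (MvPolynomial.X i ∣ gs 0)) (hfrob : MvPolynomial.map (frobenius k p) (gs 0) = gs 0)
    (SS : List (Finset (Fin n)))
    (hcov : ∀ T : Finset (Fin n), (∀ j ∈ J, ∃ i ∈ T, 0 < V i j) → ∃ S ∈ SS, S ⊆ T)
    (hcells : ∀ S ∈ SS, ∃ (L : List ((Fin n →₀ ℕ) × MvPolynomial (Fin n) k)) (rr : List (MvPolynomial (Fin n) k))
        (t : Fin n → MvPolynomial (Fin n) k) (t₀ : MvPolynomial (Fin n) k),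
        (L.map Prod.fst).Nodup ∧ (∀ e ∈ L, ∀ i : Fin n, e.1 i < p) ∧
        gs 0 ^ (p - 1) = (L.map fun e => MvPolynomial.monomial e.1 (1 : k) * MvPolynomial.expand p e.2).sum ∧
        (1 : MvPolynomial (Fin n) k) = (List.zipWith (fun r e => r * e.2) rr L).sum +
          ∑ i ∈ S, t i * MvPolynomial.X i + t₀ * gs 0) :
    ∀ (Q' : Ideal (MvPolynomial (Fin n) k ⧸ Ideal.span (Set.range gs))) [Q'.IsMaximal],
      (∀ j ∈ J, Ideal.Quotient.mk (Ideal.span (Set.range gs))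
        (aeval (fun j : Fin n => ∏ i : Fin n, (X i : MvPolynomial (Fin n) k) ^ V i j) (X j : MvPolynomial (Fin n) k)) ∈ Q') →
        (∀ i : Fin n, (X i : MvPolynomial (Fin n) k) ∈ Q'.comap (Ideal.Quotient.mk (Ideal.span (Set.range gs))) →
          IsSMulRegular (Localization.AtPrime (Q'.comap (Ideal.Quotient.mk (Ideal.span (Set.range gs)))) ⧸
              (Ideal.span (Set.range gs)).map (algebraMap (MvPolynomial (Fin n) k)
                (Localization.AtPrime (Q'.comap (Ideal.Quotient.mk (Ideal.span (Set.range gs)))))))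
            (algebraMap (MvPolynomial (Fin n) k)
              (Localization.AtPrime (Q'.comap (Ideal.Quotient.mk (Ideal.span (Set.range gs))))) (X i))) ∧
        ∀ dd : ℕ, ringKrullDim (Localization.AtPrime Q') = dd → ∀ s : Fin dd → Localization.AtPrime Q',
          (Ideal.span (Set.range s)).radical.IsMaximal →
            RingTheory.Sequence.IsWeaklyRegular (Localization.AtPrime Q') (List.ofFn s) ∧
            ∀ y : Localization.AtPrime Q', (∃ e : ℕ, y ^ p ^ e ∈ Ideal.span
              ((fun z : Localization.AtPrime Q' => z ^ p ^ e) ''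
                (Ideal.span (Set.range s) : Set (Localization.AtPrime Q')))) → y ∈ Ideal.span (Set.range s) :=
  KLocCellRange.quotientChartClause_of_pointFedder_range p k n J V gs hg0 hX fun K _ _ b hgb hθ =>
    pointFedder_of_kLocCellsU p k n J V (gs 0) hfrob SS hcov hcells K b hgb hθ

end Chart

end Summit.ResolutionOfSingularities.ResolutionOfSingularities.Theorems.FInjectiveMacaulayfication.KLocCellFrobenius

end
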